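import Literature.AnabelianGeometry.AbsoluteAnabelian.AbsTopIProp23OuterFaithfulPrimeIndex
import HarnessLib

/-!
# [AbsTopI] Prop 2.3 (i) for the quotient of a hyperbolic curve by an automorphism of PRIME order

S. Mochizuki, *Topics in Absolute Anabelian Geometry I: Generalities* (2012) [AbsTopI] (lit key
`paper:url-11ac98ba15fc`), Def 2.1 (i) p. 17, Prop 2.3 (i) p. 19; [IUTchI] Def 3.1 (b) `C_F = X_F // {±1}`,
(d) `X̲_K → C̲_K` the quotient by `±1`; [EtTh] Def 2.1 (hyperbolic orbicurves of type `(1, l-tors)^±`).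

abc-iut cell, seat abc-iut-f-051 (gen 4); PROOF-ONLY (no definition, no named fact).  Packaging of
`AbsTopIProp23OuterFaithfulPrimeIndex.lean` (p447728) for the typers of [IUTchI]/[EtTh] orbicurves: the INPUT is
an automorphism `σ` of the surface group `Γ_{g,r}` (`2g − 2 + r > 0`) of PRIME order `p` together with ONE class it
moves, `σ(a)·a⁻¹ ∉ [Γ_{g,r}, Γ_{g,r}]` (for an involution acting as `−1` on a primitive class: `σ(a)a⁻¹ ≡ a⁻²`);
the OUTPUT is [AbsTopI] Prop 2.3 (i) at the Def 2.1 (i) GFG construction for the orbicurve `[X/σ]`: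

* `exists_primeOrderAutLattice` — the lattice `Γ := Γ_{g,r} ⋊ ⟨σ⟩` (`π₁^{orb}([X/σ])` when `σ` is realised by
  an automorphism of `X`) has `H := Γ_{g,r}` normal of index `p`, the torsion element `σ ∉ H`, and
  `[Γ, Γ] ⊄ [H, H]` (witness `[σ, a] = σ(a)a⁻¹`);
* `exists_slim_and_elastic_gfgQuotient_primeOrderAut` — hence, for nonempty sets of primes `Σ ⊆ Σ′`, every
  pro-`Σ′` completion `j : Γ → P` and every open `U ⊴ P` with `j⁻¹U ≤ H` (a curve `Y → X → [X/σ]`), the almost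
  pro-`Σ`-maximal quotient `P/K_Σ(U)` is slim and elastic and has no nontrivial finite normal subgroup;
  `exists_isOpen_normal_comap_eq_of_mem` — such `U` exist as soon as `p ∈ Σ′`;
* `exists_slim_and_elastic_gfgQuotient_inversion` — the involution form (`σ² = 1`, `σ(a)·a ∈ [Γ,Γ]` for all `a`:
  `−1` on `H₁`, as for `C_F`, hyperelliptic quotients), where the witness is automatic
  (`exists_mul_self_not_mem…`-style: some `a²` lies outside `[Γ_{g,r}, Γ_{g,r}]`).

HONEST SCOPE: model-level; constructing `σ` on the presented group `Γ_{g,r}` for a given orbicurve (e.g. the `±1`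
of `C̲_K` on `Γ_{1,l}`) is the consumer's input.  Classical (pro)finite group theory; OUR kernel check; nothing here
bears on [IUTchIII] Cor. 3.12; no side is taken; typed ≠ proved elsewhere.
-/

noncomputable section

open Topology

universe u

namespace Literature.AnabelianGeometry.AbsoluteAnabelian

open Literature.AlgebraicGeometry.Frobenioids (IsSlimGroup)
open Literature.AnabelianGeometry.Anabelioids (IsSigmaInteger)
open Literature.AnabelianGeometry.SemiGraphs.SemiGraphOfAnabelioids
open Literature.AnabelianGeometry.SemiGraphs.SemiGraphOfAnabelioids.IsProSigmaCompletion
open Literature.GroupTheory.CombinatorialGroupTheory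

/-! ### The lattice `Γ_{g,r} ⋊ ⟨σ⟩` -/

/-- **The lattice of `[X/σ]` for `σ` of prime order.**  For an automorphism `σ` of `Γ_{g,r}` with `σ^p = 1`,
`σ ≠ 1` (`p` prime) and a class it moves (`σ(a)·a⁻¹ ∉ [Γ_{g,r}, Γ_{g,r}]`): the semidirect product
`Γ := Γ_{g,r} ⋊ ⟨σ⟩` has `H := Γ_{g,r}` normal of index `p`, `t := σ ∈ Γ ∖ H` with `t^p = 1 ≠ t`, and
`[Γ, Γ] ⊄ [H, H]`. [cite: MochizukiAbsTopI2012, Prop 2.3 (i) p.19] -/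
theorem exists_primeOrderAutLattice {g r : ℕ} (σ : MulAut (PuncturedSurfaceGroup g r)) {p : ℕ} (hp : p.Prime)
    (hσp : σ ^ p = 1) (hσ1 : σ ≠ 1) (a : PuncturedSurfaceGroup g r)
    (ha : σ a * a⁻¹ ∉ commutator (PuncturedSurfaceGroup g r)) :
    ∃ (Γ : Type) (_ : Group Γ) (H : Subgroup Γ) (_ : H.Normal) (t : Γ),
      H.index = p ∧ t ∉ H ∧ t ^ p = 1 ∧ t ≠ 1 ∧ Nonempty (H ≃* PuncturedSurfaceGroup g r) ∧
        ¬ commutator Γ ≤ ⁅H, H⁆ := by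
  classical
  haveI : Fact p.Prime := ⟨hp⟩
  let Z : Subgroup (MulAut (PuncturedSurfaceGroup g r)) := Subgroup.zpowers σ
  have hZ : Nat.card Z = p := by
    rw [Nat.card_zpowers]
    exact orderOf_eq_prime hσp hσ1
  let t : Z := ⟨σ, Subgroup.mem_zpowers σ⟩
  let Γ := PuncturedSurfaceGroup g r ⋊[Z.subtype] Z
  let H : Subgroup Γ := (SemidirectProduct.inl : PuncturedSurfaceGroup g r →* Γ).range
  haveI hHn : H.Normal := by
    change (SemidirectProduct.inl : PuncturedSurfaceGroup g r →* Γ).range.Normal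
    rw [SemidirectProduct.range_inl_eq_ker_rightHom]
    infer_instance
  have hHi : H.index = p := by
    change (SemidirectProduct.inl : PuncturedSurfaceGroup g r →* Γ).range.index = p
    rw [SemidirectProduct.range_inl_eq_ker_rightHom, Subgroup.index_ker,
      MonoidHom.range_eq_top.mpr SemidirectProduct.rightHom_surjective, Subgroup.card_top, hZ]
  have htH : (SemidirectProduct.inr t : Γ) ∉ H := by
    intro h
    change SemidirectProduct.inr t ∈ (SemidirectProduct.inl : PuncturedSurfaceGroup g r →* Γ).range at h
    rw [SemidirectProduct.range_inl_eq_ker_rightHom, MonoidHom.mem_ker, SemidirectProduct.rightHom_inr] at h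
    exact hσ1 (congrArg Subtype.val h)
  have htp : (SemidirectProduct.inr t : Γ) ^ p = 1 := by
    rw [← map_pow, ← map_one (SemidirectProduct.inr : Z →* Γ)]
    congr 1
    exact Subtype.ext (by simpa using hσp)
  have ht1 : (SemidirectProduct.inr t : Γ) ≠ 1 := fun h => htH (h ▸ H.one_mem)
  refine ⟨Γ, inferInstance, H, hHn, SemidirectProduct.inr t, hHi, htH, htp, ht1,
    ⟨(MonoidHom.ofInjective SemidirectProduct.inl_injective).symm⟩,
    not_commutator_le_of_witness H (x := SemidirectProduct.inr t) (y := SemidirectProduct.inl a) ?_⟩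
  -- `[t, inl a] = inl (σ a · a⁻¹) ∉ [H, H] = inl [Γ_{g,r}, Γ_{g,r}]`
  have h1 : (SemidirectProduct.inr t : Γ) * SemidirectProduct.inl a * (SemidirectProduct.inr t)⁻¹ =
      SemidirectProduct.inl (σ a) := by
    rw [← map_inv, ← SemidirectProduct.inl_aut]
    rfl
  have hconj : (SemidirectProduct.inr t : Γ) * SemidirectProduct.inl a * (SemidirectProduct.inr t)⁻¹ *
      (SemidirectProduct.inl a)⁻¹ = SemidirectProduct.inl (σ a * a⁻¹) := by
    rw [h1, ← map_inv, ← map_mul]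
  rw [hconj]
  change SemidirectProduct.inl (σ a * a⁻¹) ∉
    ⁅(SemidirectProduct.inl : PuncturedSurfaceGroup g r →* Γ).range,
      (SemidirectProduct.inl : PuncturedSurfaceGroup g r →* Γ).range⁆
  rw [MonoidHom.range_eq_map, ← Subgroup.map_commutator, ← commutator_def]
  intro hmem
  obtain ⟨x, hx, hxe⟩ := Subgroup.mem_map.mp hmem
  exact ha (SemidirectProduct.inl_injective hxe ▸ hx)

/-- For an INVOLUTION `σ` of a hyperbolic `Γ_{g,r}` acting as `−1` on `H₁` (`σ(x)·x ∈ [Γ,Γ]` for all `x`; the `±1`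
of `C_F`, of `C̲_K`, hyperelliptic involutions), the witness is automatic: some square `a²` lies outside
`[Γ_{g,r}, Γ_{g,r}]` (a character to `ℤ/4` with value `1`), and `σ(a)a⁻¹ ≡ a⁻²`.
[cite: MochizukiAbsTopI2012, Prop 2.3 (i) p.19] -/
theorem exists_conj_witness_of_inversion {g r : ℕ} (hgr : PuncturedSurfaceGroup.IsHyperbolicType g r)
    (σ : MulAut (PuncturedSurfaceGroup g r)) (hσ : ∀ x, σ x * x ∈ commutator (PuncturedSurfaceGroup g r)) :
    ∃ a : PuncturedSurfaceGroup g r, σ a * a⁻¹ ∉ commutator (PuncturedSurfaceGroup g r) := by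
  obtain ⟨f, a, hfa⟩ := PuncturedSurfaceGroup.exists_monoidHom_zmod_apply_eq_ofAdd_one hgr 4
  refine ⟨a, fun hmem => ?_⟩
  have ha2 : a⁻¹ * a⁻¹ ∈ commutator (PuncturedSurfaceGroup g r) := by
    have : a⁻¹ * a⁻¹ = (σ a * a)⁻¹ * (σ a * a⁻¹) := by group
    rw [this]
    exact Subgroup.mul_mem _ (Subgroup.inv_mem _ (hσ a)) hmem
  have h1 : f (a⁻¹ * a⁻¹) = 1 := Abelianization.commutator_subset_ker f ha2
  rw [map_mul, map_inv, hfa, ← ofAdd_neg, ← ofAdd_add, ← ofAdd_zero] at h1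
  exact absurd (Multiplicative.ofAdd.injective h1) (by decide)

/-! ### Prop 2.3 (i) for `[X/σ]` at the GFG construction -/

/-- For a pro-`Σ′` completion `j : Γ → P` with `p ∈ Σ′` and `H ⊴ Γ` of prime index `p`, there is an open normal
`U ⊴ P` with `j⁻¹U = H`. [cite: MochizukiAbsTopI2012, Def 2.1 (i) p.17] -/
theorem exists_isOpen_normal_comap_eq_of_mem {Γ : Type*} [Group Γ] {P : Type u} [Group P] [TopologicalSpace P]
    [IsTopologicalGroup P] [CompactSpace P] [TotallyDisconnectedSpace P] {Sigma' : Set ℕ} {j : Γ →* P}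
    (hj : IsProSigmaCompletion Sigma' j) {p : ℕ} (hp : p.Prime) (hpS : p ∈ Sigma') (H : Subgroup Γ)
    [hHn : H.Normal] (hH : H.index = p) :
    ∃ U : Subgroup P, U.Normal ∧ IsOpen (U : Set P) ∧ U.comap j = H := by
  have hint : IsSigmaInteger Sigma' H.index := by
    rw [hH]
    exact ⟨hp.pos, fun q hq hqp => by rwa [(Nat.prime_dvd_prime_iff_eq hq hp).mp hqp]⟩
  obtain ⟨U, hUo, hUc⟩ := hj.comap_surj H hHn hint
  exact ⟨U, normal_of_comap_normal hj U hUo (by rw [hUc]; exact hHn), hUo, hUc⟩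

/-- **[AbsTopI] Prop 2.3 (i) for the orbicurve `[X/σ]`, `σ` of prime order, at the Def 2.1 (i) GFG construction,
OUTRIGHT.**  For `σ ∈ Aut Γ_{g,r}` (hyperbolic) with `σ^p = 1 ≠ σ`, `p` prime, moving a class
(`σ(a)a⁻¹ ∉ [Γ_{g,r}, Γ_{g,r}]`), there is a lattice `Γ ⊇ H ≅ Γ_{g,r}` (`Γ = Γ_{g,r} ⋊ ⟨σ⟩`, `[Γ : H] = p`, a torsion
element of order `p` outside `H`) such that for all nonempty sets of primes `Σ ⊆ Σ′`, every pro-`Σ′` completion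
`j : Γ → P` and every open `U ⊴ P` with `j⁻¹U ≤ H`, the almost pro-`Σ`-maximal quotient `P/K` of Def 2.1 (i) is slim,
elastic, and without nontrivial finite normal subgroups. [cite: MochizukiAbsTopI2012, Prop 2.3 (i) p.19] -/
theorem exists_slim_and_elastic_gfgQuotient_primeOrderAut {g r : ℕ}
    (hgr : PuncturedSurfaceGroup.IsHyperbolicType g r) (σ : MulAut (PuncturedSurfaceGroup g r)) {p : ℕ}
    (hp : p.Prime) (hσp : σ ^ p = 1) (hσ1 : σ ≠ 1) (a : PuncturedSurfaceGroup g r)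
    (ha : σ a * a⁻¹ ∉ commutator (PuncturedSurfaceGroup g r)) :
    ∃ (Γ : Type) (_ : Group Γ) (H : Subgroup Γ) (_ : H.Normal) (t : Γ),
      H.index = p ∧ t ∉ H ∧ t ^ p = 1 ∧ t ≠ 1 ∧ Nonempty (H ≃* PuncturedSurfaceGroup g r) ∧
      ∀ {Sigma Sigma' : Set ℕ}, Sigma ⊆ Sigma' → Sigma.Nonempty → (∀ q ∈ Sigma, q.Prime) →
        ∀ {P : Type} [Group P] [TopologicalSpace P] [IsTopologicalGroup P] [CompactSpace P] [T2Space P]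
          [TotallyDisconnectedSpace P] {j : Γ →* P}, IsProSigmaCompletion Sigma' j →
          ∀ (U : Subgroup P) [U.Normal], IsOpen (U : Set P) → U.comap j ≤ H →
            ∃ (K : Subgroup P) (_ : K.Normal) (_ : IsClosed (K : Set P)), K ≤ U ∧
              Literature.AnabelianGeometry.SemiGraphs.PSCDatum.IsMaxProSigmaQuotient Sigma
                ((QuotientGroup.mk' K).subgroupMap U) ∧
              IsSlimGroup (P ⧸ K) ∧ IsElastic (P ⧸ K) ∧
              ∀ N : Subgroup (P ⧸ K), N.Normal → (N : Set (P ⧸ K)).Finite → N = ⊥ := by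
  obtain ⟨Γ, _, H, hHn, t, hHi, htH, htp, ht1, ⟨eH⟩, hw⟩ := exists_primeOrderAutLattice σ hp hσp hσ1 a ha
  refine ⟨Γ, inferInstance, H, hHn, t, hHi, htH, htp, ht1, ⟨eH⟩, ?_⟩
  intro Sigma Sigma' hSS hS hSp P _ _ _ _ _ _ j hj U _ hUo hUH
  exact exists_slim_and_elastic_gfgQuotient_of_index_prime_lattice H hp hHi hw hgr eH hSS hS hSp hj U hUo hUH

/-- **The involution form** (`C_F = X_F/±1`, `C̲_K = X̲_K/±1`, hyperelliptic quotients): for an involution `σ` of a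
hyperbolic `Γ_{g,r}` acting as `−1` on `H₁` (`σ ≠ 1`, `σ² = 1`, `σ(x)·x ∈ [Γ,Γ]` for all `x`), the conclusion of
`exists_slim_and_elastic_gfgQuotient_primeOrderAut` holds with `p = 2` — no witness needed.
[cite: MochizukiAbsTopI2012, Prop 2.3 (i) p.19] -/
theorem exists_slim_and_elastic_gfgQuotient_inversion {g r : ℕ}
    (hgr : PuncturedSurfaceGroup.IsHyperbolicType g r) (σ : MulAut (PuncturedSurfaceGroup g r))
    (hσ2 : σ ^ 2 = 1) (hσ1 : σ ≠ 1) (hσ : ∀ x, σ x * x ∈ commutator (PuncturedSurfaceGroup g r)) :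
    ∃ (Γ : Type) (_ : Group Γ) (H : Subgroup Γ) (_ : H.Normal) (t : Γ),
      H.index = 2 ∧ t ∉ H ∧ t ^ 2 = 1 ∧ t ≠ 1 ∧ Nonempty (H ≃* PuncturedSurfaceGroup g r) ∧
      ∀ {Sigma Sigma' : Set ℕ}, Sigma ⊆ Sigma' → Sigma.Nonempty → (∀ q ∈ Sigma, q.Prime) →
        ∀ {P : Type} [Group P] [TopologicalSpace P] [IsTopologicalGroup P] [CompactSpace P] [T2Space P]
          [TotallyDisconnectedSpace P] {j : Γ →* P}, IsProSigmaCompletion Sigma' j →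
          ∀ (U : Subgroup P) [U.Normal], IsOpen (U : Set P) → U.comap j ≤ H →
            ∃ (K : Subgroup P) (_ : K.Normal) (_ : IsClosed (K : Set P)), K ≤ U ∧
              Literature.AnabelianGeometry.SemiGraphs.PSCDatum.IsMaxProSigmaQuotient Sigma
                ((QuotientGroup.mk' K).subgroupMap U) ∧
              IsSlimGroup (P ⧸ K) ∧ IsElastic (P ⧸ K) ∧
              ∀ N : Subgroup (P ⧸ K), N.Normal → (N : Set (P ⧸ K)).Finite → N = ⊥ := by
  obtain ⟨a, ha⟩ := exists_conj_witness_of_inversion hgr σ hσ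
  exact exists_slim_and_elastic_gfgQuotient_primeOrderAut hgr σ Nat.prime_two hσ2 hσ1 a ha

end Literature.AnabelianGeometry.AbsoluteAnabelian

end
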